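import Summits.Ventures.HodgeRepro.Night1ReducedPullback

/-!
# Artin independence on the kernel: the component projections are POLYNOMIALS in the torus action — Lemma
R's «isolates each eigen-component» as an identity of operators on `⋀^n ℂ^Y`

Blind re-derivation cell `pub-hodge-repro`, seat `night-1` (gen 6).  Imports night-1's `Night1ReducedPullback`
(the pull-back `pullLin`, the component projections `wedgeComponent s : ω ↦ ⟨e^*_s, ω⟩ e_s`, the diagonal torus
`torusOn t` whose weight vectors are the coordinate wedges, and Lemma R's sentence
`wedgeComponent_lineEnum_map_pullLin_reducedWedge`).  Namespace `HodgeRepro.RouteC`.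

ROUTE.md §1 row S3ᴿ (Lemma R): «Artin independence of the characters `∏_i s_i(φ_i)` of `(F^×)^{2p}` (`F` acting
on each corner by algebraic endomorphisms) isolates each eigen-component of a `ℚ`-rational pull-back».  On
the model the characters of `(F^ι ⊗ ℂ)^× = (ℂ^×)^{ι × G}` on the coordinate wedges are `t ↦ ∏_{q ∈ S} t_q`,
distinct for distinct sets `S`; ONE torus element `t` separates all of them at once — `sepWeight y = 2^{2^{idx y}}`,
whose weights `∏_{y ∈ S} 2^{2^{idx y}} = 2^{Σ_{y∈S} 2^{idx y}}` are distinct for distinct `S` (binary expansion,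
Mathlib's `Finset.geomSum_injective`) — and Lagrange interpolation on the finitely many weights of the
`n`-sets gives a polynomial `P_{S₀}` with `P_{S₀}(w_{S₀}) = 1`, `P_{S₀}(w_S) = 0` otherwise:

* `sepWeight`, `weightOf t S = ∏_{y ∈ S} t y`, **`weightOf_sepWeight_injective`**;
* `aeval_map_torusOn_coordWedgeOn` — `P(⋀^n μ_t) e_s = P(w_{range s}) e_s`;
* `projectorPoly n S₀` — the Lagrange polynomial; **`aeval_projectorPoly_eq_wedgeComponent`** — for injective
  `s₀`, `P_{range s₀}(⋀^n μ_{sepWeight}) = wedgeComponent s₀` as linear maps (equality on the wedge basis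
  `coordBasisOn`): THE COMPONENT PROJECTION IS A POLYNOMIAL IN THE ACTION OF ONE ELEMENT OF `(F^ι ⊗ ℂ)^×`;
* **`weilWedgeProd_eq_aeval_projectorPoly_map_pullLin`** — Lemma R's Artin form: the `σ`-line of `W_F(B)` is
  `P_{lineSet σ}(⋀^{2k} μ_t)` applied to the pull-back `m^* e_{U_σ}` of the reduced Hodge class of `B_red` —
  so once `m^*` and the `(F^ι)^×`-action are algebraic correspondences (paper: the sum map and `F ⊂ End⁰`,
  ROUTE.md S3ᴿ / M2 Cor 5.6), the `σ`-line is algebraic whenever `e_{U_σ}` is.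

What stays paper-level: the identification of `⋀^n μ_t` with an algebraic correspondence (`t ∈ F^ι ⊗ ℂ` is
not in `F^ι`: the printed argument uses the `ℚ`-rationality of the pull-back and the `ℚ`-algebra generated
by the correspondences `a^*`, `a ∈ (F^ι)^×`, which contains the same projectors by Artin independence —
typer-2's `Isotypic.lean` has the projector-as-polynomial lemma over `ℚ`); nothing geometric is built.
Nothing here says anything about the status of the Hodge conjecture for CM abelian varieties, which is NOT
proved.
-/

set_option autoImplicit false

open Finset Module Polynomial
open scoped Pointwise

namespace HodgeRepro.RouteC

open CMHodgeOn

/-! ### A torus element separating all sets -/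

section Weights

variable {Y : Type*} [Fintype Y] [DecidableEq Y]

/-- The index of `y` in `Fin |Y|`, as a natural number (an injection `Y ↪ ℕ`). -/
noncomputable def idxEmb (Y : Type*) [Fintype Y] : Y ↪ ℕ :=
  ⟨fun y => ((Fintype.equivFin Y) y : ℕ), fun _ _ h => (Fintype.equivFin Y).injective (Fin.ext h)⟩

/-- **The separating torus element** `t y = 2^{2^{idx y}}`. -/
noncomputable def sepWeight (Y : Type*) [Fintype Y] : Y → ℂ := fun y => (2 : ℂ) ^ (2 ^ idxEmb Y y)

/-- The weight (character value) of a set `S` at the torus element `t`: `∏_{y ∈ S} t y`. -/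
def weightOf (t : Y → ℂ) (S : Finset Y) : ℂ := ∏ y ∈ S, t y

omit [DecidableEq Y] in
/-- The weight of `S` at `sepWeight` is `2` to the binary number with digits `S`. -/
theorem weightOf_sepWeight (S : Finset Y) :
    weightOf (sepWeight Y) S = ((2 ^ (∑ y ∈ S, 2 ^ idxEmb Y y) : ℕ) : ℂ) := by
  unfold weightOf sepWeight
  rw [Finset.prod_pow_eq_pow_sum]
  push_cast
  rfl

omit [DecidableEq Y] in
/-- **`sepWeight` separates the sets**: distinct sets have distinct weights (`Finset.geomSum_injective`). -/
theorem weightOf_sepWeight_injective : Function.Injective (weightOf (sepWeight Y)) := by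
  intro S S' h
  rw [weightOf_sepWeight, weightOf_sepWeight] at h
  have h1 : ∑ y ∈ S, 2 ^ idxEmb Y y = ∑ y ∈ S', 2 ^ idxEmb Y y :=
    Nat.pow_right_injective (le_refl 2) (Nat.cast_injective h)
  rw [← Finset.sum_map S (idxEmb Y) (fun i => 2 ^ i), ← Finset.sum_map S' (idxEmb Y) (fun i => 2 ^ i)] at h1
  exact Finset.map_injective (idxEmb Y) (Finset.geomSum_injective (le_refl 2) h1)

omit [Fintype Y] in
/-- The coordinate wedge of an injective `s` is a weight vector of the torus, of weight `weightOf t (range s)`. -/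
theorem map_torusOn_coordWedgeOn_eq_weightOf (t : Y → ℂ) {n : ℕ} {s : Fin n → Y}
    (hs : Function.Injective s) :
    exteriorPower.map n (torusOn t) (coordWedgeOn n s) = weightOf t (univ.image s) • coordWedgeOn n s := by
  rw [map_torusOn_coordWedgeOn, weightOf, Finset.prod_image fun a _ b _ hab => hs hab]

omit [Fintype Y] in
/-- **A polynomial in the torus action acts on a coordinate wedge by its value at the weight**:
`P(⋀^n μ_t) e_s = P(w_{range s}) • e_s`. -/
theorem aeval_map_torusOn_coordWedgeOn (t : Y → ℂ) (P : ℂ[X]) {n : ℕ} {s : Fin n → Y}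
    (hs : Function.Injective s) :
    aeval (exteriorPower.map n (torusOn t)) P (coordWedgeOn n s) =
      P.eval (weightOf t (univ.image s)) • coordWedgeOn n s :=
  Module.End.aeval_apply_of_mem_apply_eq_smul (map_torusOn_coordWedgeOn_eq_weightOf t hs)

end Weights

/-! ### The Lagrange projector and the identity of operators -/

section Projector

variable {Y : Type*} [Fintype Y] [DecidableEq Y]

omit [Fintype Y] in
/-- The component projection fixes every wedge of the SAME set (two enumerations differ by a sign, which
the dual functional reads back). -/
theorem wedgeComponent_coordWedgeOn_of_image_eq {n : ℕ} {s s' : Fin n → Y} (hs : Function.Injective s)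
    (hs' : Function.Injective s') (h : univ.image s = univ.image s') :
    wedgeComponent s (coordWedgeOn n s') = coordWedgeOn n s' := by
  obtain ⟨π, hπ⟩ := coordWedgeOn_eq_sign_smul_of_image_eq hs hs' h
  rw [hπ, map_smul, wedgeComponent_coordWedgeOn_self hs]

/-- **The projector polynomial** of the set `S₀` among the `n`-sets: the Lagrange interpolation polynomial
with value `1` at `weightOf sepWeight S₀` and `0` at the weights of the other `n`-sets. -/
noncomputable def projectorPoly (n : ℕ) (S₀ : Finset Y) : ℂ[X] :=
  Lagrange.interpolate (univ : Finset (SizedSets Y n)) (fun S => weightOf (sepWeight Y) S.1)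
    (fun S => if S.1 = S₀ then 1 else 0)

/-- The projector polynomial takes the value `1` at the weight of `S₀` and `0` at the other `n`-sets. -/
theorem eval_projectorPoly (n : ℕ) (S₀ : Finset Y) (S : SizedSets Y n) :
    (projectorPoly n S₀).eval (weightOf (sepWeight Y) S.1) = if S.1 = S₀ then 1 else 0 :=
  Lagrange.eval_interpolate_at_node (v := fun S : SizedSets Y n => weightOf (sepWeight Y) S.1)
    (r := fun S : SizedSets Y n => if S.1 = S₀ then (1 : ℂ) else 0)
    (fun _ _ _ _ hSS' => Subtype.ext (weightOf_sepWeight_injective hSS')) (mem_univ S)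

/-- **THE COMPONENT PROJECTION IS A POLYNOMIAL IN THE TORUS ACTION**: for injective `s₀`,
`P_{range s₀}(⋀^n μ_{sepWeight}) = wedgeComponent s₀` as linear maps on `⋀^n ℂ^Y` (equality on the wedge basis
`coordBasisOn`: on `e_T` both sides give `e_T` if `range T = range s₀` and `0` otherwise). -/
theorem aeval_projectorPoly_eq_wedgeComponent {n : ℕ} {s₀ : Fin n → Y} (hs₀ : Function.Injective s₀) :
    aeval (exteriorPower.map n (torusOn (sepWeight Y))) (projectorPoly n (univ.image s₀)) =
      wedgeComponent s₀ := by
  refine ((coordBasisOn Y).exteriorPower n).ext fun T => ?_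
  rw [coordBasisOn_exteriorPower_apply]
  have hT := enumOfOn_injective n T
  rw [aeval_map_torusOn_coordWedgeOn _ _ hT]
  have hcard : (univ.image (enumOfOn n T)).card = n := by
    rw [card_image_of_injective _ hT, card_univ, Fintype.card_fin]
  rw [eval_projectorPoly n (univ.image s₀) ⟨univ.image (enumOfOn n T), hcard⟩]
  by_cases h : univ.image (enumOfOn n T) = univ.image s₀
  · rw [if_pos h, one_smul, wedgeComponent_coordWedgeOn_of_image_eq hs₀ hT h.symm]
  · rw [if_neg h, zero_smul, wedgeComponent_coordWedgeOn_of_image_ne hs₀ hT (Ne.symm h)]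

/-- The component of any class is a polynomial in the torus action applied to it. -/
theorem wedgeComponent_eq_aeval_projectorPoly {n : ℕ} {s₀ : Fin n → Y} (hs₀ : Function.Injective s₀)
    (ω : ⋀[ℂ]^n (Y → ℂ)) :
    wedgeComponent s₀ ω = aeval (exteriorPower.map n (torusOn (sepWeight Y))) (projectorPoly n (univ.image s₀)) ω := by
  rw [aeval_projectorPoly_eq_wedgeComponent hs₀]

end Projector

/-! ### Lemma R in its Artin form -/

section LemmaR

variable {G : Type*} [Group G] [DecidableEq G] [Fintype G] {ι J : Type*} [Fintype ι] [DecidableEq ι]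
  [DecidableEq J]

/-- **LEMMA R, ARTIN FORM, ON THE KERNEL**: for injective `(cls, tw)`, the `σ`-line of `W_F(B)` is the
projector polynomial `P_{lineSet σ}` of ONE element of the torus `(F^ι ⊗ ℂ)^×` applied to the pull-back
`m^* e_{U_σ}` of the reduced Hodge class of `B_red` along the sum map — «Artin independence of the characters
isolates the eigen-component» (ROUTE.md S3ᴿ), as an identity of vectors. -/
theorem weilWedgeProd_eq_aeval_projectorPoly_map_pullLin {cls : ι → J} {tw : ι → G}
    (hinj : Function.Injective fun i => (cls i, tw i)) {k : ℕ} (e : Fin (2 * k) ≃ ι) (σ : G) :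
    aeval (exteriorPower.map (2 * k) (torusOn (sepWeight (ι × G)))) (projectorPoly (2 * k) (lineSet (ι := ι) σ))
        (exteriorPower.map (2 * k) (pullLin (twistMap cls tw))
          (coordWedgeOn (2 * k) (reducedEnum cls tw e σ))) =
      weilWedgeProd e σ := by
  rw [← image_lineEnum e σ, aeval_projectorPoly_eq_wedgeComponent (lineEnum_injective e σ)]
  exact wedgeComponent_lineEnum_map_pullLin_reducedWedge hinj e σ

end LemmaR

end HodgeRepro.RouteC
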